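import Summits.BirchSwinnertonDyer.BirchSwinnertonDyer.Theorems.EisensteinPrimesBSDpOnCellCOfNamedFactsV16
import Summits.BirchSwinnertonDyer.BirchSwinnertonDyer.Theorems.EisensteinPrimesBSDpOnCellCMemberInvariantsOfAnacongWt
import Literature.NumberTheory.EllipticCurves.KellerYin2024.HidaMemberAnticyclotomicMainConjecture
import HarnessLib

/-!
# Crux 4 `BSDpOnCellC` (stmt-BirchSwinnertonDyer-19034), line «telescope»: K1 `stub_memberDiv` BY NAME from the typed Keller–Yin 2024 Thm. 3.0.8
# (`KellerYin2024.thm308_imc2_hidaMember_dvd_OPEN`, ARM-P typer T2, p721227) and the composition V16P whose binders are the FIVE stub texts of telescope v2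
# (`stub_publishedFacts` 24 PUB · `stub_preprintFacts` = the THREE Keller–Yin preprint statements BY NAME · `stub_telescopeCarrier` · `stub_wallAlgebraic` · `stub_mazurMC_cellB`)

Cell `bsd-eis` (home `run/shared/lean/pub/bsd-eis/`), successor LEAD `cruxlead-19034` g1; `--supports stmt-BirchSwinnertonDyer-19034`. Skeleton of record: telescope v1
(sha256 1d5bbb30…, 6 stubs). This file prepares the v2 RESHAPE under director-bsd g18's RESTUB SHAPE OF RECORD (2026-08-29T12:57Z, VARIANT-N): every print /
preprint statement the skeleton needs enters BY NAME as a conjunct of a declared cite stub; content stubs stay separate.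

* `memberDiv_of_thm308 : thm308_imc2_hidaMember_dvd_OPEN → <the registered text of stub_memberDiv>` — the 3-line bridge of typer `bsd-armP-typer-19034-T2` g0
  (scratch `HOME/bsd-armP-typer-19034-T2-g0/BRIDGE-stub_memberDiv-scratch.lean`, kernel-checked there), landed here: the Literature typing's binders ARE the
  stub's with `CellC W p` unfolded to `2 < p ∧ Red W p ∧ p` multiplicative (`MemberInvariantsOfAnacongWt.two_lt_of_cellC / red_of_cellC / mult_of_cellC`,
  x2-p2 g13) and `R1.unrToCpInt p ≡ unrToInt` (rfl). So K1 is PURE-CITE (preprint tier, claim-tagged) from now on.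
* `bsdpOnCellC_of_namedFactsV16P hPub24 hPre hCar hWall hMCB : BSDpOnCellC` := `…V16T hPub24 (memberDiv_of_thm308 hPre.1) hCar ⟨hPre.2.1, hPre.2.2⟩ hWall hMCB`
  with `hPre : thm308_imc2_hidaMember_dvd_OPEN ∧ thm222_anacong_hidaMember_sigma_mu_OPEN ∧ thm222_anacong_hidaMember_sigma_lambda_OPEN` — binders = the FIVE
  stub texts of telescope v2, so that v2 = imports + 5 stubs + `BSDpOnCellC_of := …V16P stub_publishedFacts stub_preprintFacts stub_telescopeCarrier
  stub_wallAlgebraic stub_mazurMC_cellB`.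

HONEST RESIDUAL of crux 4 on telescope (v2 reading): 24 refereed PUB(-chain) named facts + 3 Keller–Yin preprint-grade named statements (Thm. 3.0.8 at one
crystalline member; Thm. 2.2.2 μ / λ at weight `k`) + crux 3 + K2 `stub_telescopeCarrier` (research-sized ∃-construction) + the preprint-grade character-level
texts of `stub_wallAlgebraic`. CONDITIONAL-RESULT; nothing asserted; no summit statement, no BSD / MC / IMC is proved for any curve; 0 cells / labels / tiers move.

References: [KellerYin2024] Thm. 3.0.8 (IMC2), Rem. 3.0.9, Thm. 2.2.2, Thm. 1.2.2, Thm. 5.1.3 (arXiv:2402.12781v2; shape only); as in `…OfNamedFactsV16`.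
-/

set_option autoImplicit false
set_option linter.dupNamespace false

noncomputable section


open scoped Classical MatrixGroups ModularForm

open CongruenceSubgroup WeierstrassCurve NumberField IsDedekindDomain Field PowerSeries
  Literature.NumberTheory.EllipticCurves Literature.NumberTheory.EllipticCurves.GreenbergSelmer
  Literature.NumberTheory.EllipticCurves.ModularForms Literature.NumberTheory.QuadraticFields
  Literature.NumberTheory.EllipticCurves.Rank1Residual
  Literature.NumberTheory.EllipticCurves.Rank1Residual.Typed
  Literature.NumberTheory.EllipticCurves.KrizLi2019
  Literature.NumberTheory.EllipticCurves.GreenbergVatsal2000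
  Literature.NumberTheory.EllipticCurves.Wuthrich2014
  Literature.NumberTheory.EllipticCurves.SteinWuthrich2013
  Literature.NumberTheory.EllipticCurves.Castella2018Exceptional
  Literature.NumberTheory.GaloisRepresentations Literature.NumberTheory.GaloisCohomology
  Literature.NumberTheory.Automorphic
  Summit.BirchSwinnertonDyer.Rank1Residual.X11b.AcSelmer
  Summit.BirchSwinnertonDyer.Rank1Residual.X11b.Halves
  Summit.BirchSwinnertonDyer.Rank1Residual.X11b
  Summit.BirchSwinnertonDyer.Rank1Residual Summit.BirchSwinnertonDyer.Rank1Residual.X1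
  Summit.BirchSwinnertonDyer.Rank1Residual.X2
open Literature.NumberTheory.EllipticCurves.KellerYin2024 (curveLocalLambda)
open Literature.NumberTheory.EllipticCurves.BigGaloisRep



namespace Summit.BirchSwinnertonDyer.BirchSwinnertonDyer.Theorems.MemberDivOfThm308

open Literature.NumberTheory.EllipticCurves.CastellaGrossiLeeSkinner2022 Literature.NumberTheory.EllipticCurves.Castella2018
  Literature.NumberTheory.IwasawaTheory Literature.NumberTheory.IwasawaTheory.Greenberg2016
  Literature.NumberTheory.IwasawaTheory.Greenberg2006
  Summit.BirchSwinnertonDyer.Rank1Residual.X1.KellerYinMuLambdaSplit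
open Literature.NumberTheory.EllipticCurves.KellerYin2024
open Summit.BirchSwinnertonDyer.BirchSwinnertonDyer.Theorems.EisensteinPrimesBSDpOnCellCOfNamedFactsV16 (bsdpOnCellC_of_namedFactsV16T)

/-- **K1 `stub_memberDiv` BY NAME**: the typed Keller–Yin 2024 Thm. 3.0.8 `thm308_imc2_hidaMember_dvd_OPEN` (typer T2, p721227) gives the registered text of
`stub_memberDiv` token for token — `CellC W p` unfolds to `2 < p`, `Red W p`, `p` multiplicative (x2-p2 g13's `MemberInvariantsOfAnacongWt.*_of_cellC`), and
`R1.unrToCpInt p` is `unrToInt` by `rfl`. Bridge text: typer bsd-armP-typer-19034-T2 g0. CONDITIONAL on an unrefereed claim; nothing asserted.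
[claim: KellerYin2024, status: under-review] [cite: KellerYin2024, Thm. 3.0.8 (IMC2) and Rem. 3.0.9 (arXiv:2402.12781v2 p. 40) (shape only)] -/
theorem memberDiv_of_thm308 (h : thm308_imc2_hidaMember_dvd_OPEN) :
    ∀ (W : WeierstrassCurve ℚ) [W.IsElliptic] [W.IsGloballyMinimal] (p : ℕ) [Fact p.Prime],
      CellC W p →
      ∀ (N : ℕ) [NeZero N] (K : Type) [Field K] [NumberField K],
        W.conductorNorm ℤ = N →
        IsImaginaryQuadratic K → NumberField.discr K < -4 → SatisfiesHeegnerHypothesis N K →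
        Odd (NumberField.discr K) →
        ∀ (κ : ZpExtension K p), κ.IsAnticyclotomic →
          ∀ (γ : Field.absoluteGaloisGroup K) [Fact (κ.IsTopGenerator γ)]
            (𝔭 : HeightOneSpectrum (𝓞 K)), ((p : ℕ) : 𝓞 K) ∈ 𝔭.asIdeal →
            𝔭.asIdeal.ramificationIdx (𝓞 ℚ) = 1 → 𝔭.asIdeal.inertiaDeg (𝓞 ℚ) = 1 →
            ∀ (𝔭bar : HeightOneSpectrum (𝓞 K)), ((p : ℕ) : 𝓞 K) ∈ 𝔭bar.asIdeal → 𝔭bar ≠ 𝔭 →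
              ((Ideal.span {(p : ℤ)}).primesOver (𝓞 K)).ncard = 2 →
            ∀ (ι' : PadicAlgCl p ≃+* ℂ),
              (∀ (w : InfinitePlace K) (k : 𝓞 K), k ∈ 𝔭.asIdeal ↔ ‖ι'.symm (w.embedding (k : K))‖ < 1) →
            ∀ (D : Skinner2016.HidaCongruentForm W p 1),
              (∀ y : coeffField D.g, ι' (D.ι y) = (y : ℂ)) → 2 * ((p : ℤ) - 1) ∣ D.k - 2 →
              ∀ (b : padicCoeffIntegers D.ι →+* 𝓞_ℂ_[p]),
                (∀ y, ((b y : 𝓞_ℂ_[p]) : ℂ_[p]) =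
                  algebraMap (PadicAlgCl p) ℂ_[p] (padicCoeffIntegers.toPadicAlgCl D.ι y)) →
              ∀ (ΩKg : ℂ) (Ωpg : ℂ_[p]) (Lg : UnrSeries p), ΩKg ≠ 0 → ‖Ωpg‖ = 1 →
                IsBDPLFunctionWt ι' 𝔭 κ γ D.g ΩKg Ωpg Lg →
              ∀ [TopologicalSpace (PowerSeries (padicCoeffIntegers D.ι))]
                [ContinuousSMul (PowerSeries (padicCoeffIntegers D.ι))
                  (BigRepModule (padicCoeffIntegers D.ι) p (Cofree D.Δ.selfDualRep (padicCoeffField D.ι)))],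
                ∃ c : ℕ, PowerSeries.C ((p : 𝓞_ℂ_[p]) ^ c) * PowerSeries.map (R1.unrToCpInt p) Lg ∈
                  (XBig.charIdeal κ (D.Δ.selfDualCofreeRepOver K) 𝔭bar
                    (∅ : Set (HeightOneSpectrum (𝓞 K)))).map (PowerSeries.map b) := by
  intro W _ _ p _ hC N _ K _ _ hN hK hdisc hH hodd κ hκ γ _ 𝔭 h𝔭 he hf 𝔭bar h𝔭bar hne hsplit ι' hι' D hDι hpar b hb
    ΩKg Ωpg Lg hΩK hΩp hL _ _
  exact h W p (MemberInvariantsOfAnacongWt.two_lt_of_cellC hC) (MemberInvariantsOfAnacongWt.red_of_cellC hC)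
    (MemberInvariantsOfAnacongWt.mult_of_cellC hC) N K hN hK hdisc hH hodd κ hκ γ 𝔭 h𝔭 he hf 𝔭bar h𝔭bar hne hsplit
    ι' hι' D hDι hpar b hb ΩKg Ωpg Lg hΩK hΩp hL

set_option maxHeartbeats 1600000 in
/-- **Crux 4 `BSDpOnCellC` BY NAME from the FIVE stub texts of telescope v2 (V16P)**: `stub_publishedFacts` (24 refereed named facts), `stub_preprintFacts`
(the three Keller–Yin preprint statements BY NAME: Thm. 3.0.8 at one member = K1, Thm. 2.2.2 μ and λ at weight `k`), `stub_telescopeCarrier` (K2+D3),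
`stub_wallAlgebraic`, `stub_mazurMC_cellB` — := V16T with K1 fed by `memberDiv_of_thm308 hPre.1` and the member pair by `⟨hPre.2.1, hPre.2.2⟩`. The one-line
composition of telescope v2. CONDITIONAL; nothing asserted.
[claim: KellerYin2024, status: under-review] [cite: KellerYin2024, Thm. 3.0.8, Thm. 2.2.2, Thm. 1.2.2, Thm. 5.1.3 (arXiv:2402.12781v2) (shape only)]
[cite: Castella2020JIMJ, Def. 2.10 and Thm. 2.11 (shape only)] [cite: CastellaGrossiLeeSkinner2022, Prop. 1.2.5, Thm. 1.2.2, Thm. 2.1.2, Thm. 2.2.2] -/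
theorem bsdpOnCellC_of_namedFactsV16P
    (hPub :
    (((lambdaMu_multiplicative_of_gvPar ∧ thm16_charIdeal_dvd_multiplicative_of_reducible ∧
    thm61_splitMultiplicative ∧ thm61_nonsplitMultiplicative ∧
    (∀ (W : WeierstrassCurve ℚ) [W.IsElliptic] [W.IsGloballyMinimal] (p : ℕ) [Fact p.Prime],
      greenberg_stevens (W := W) (p := p)) ∧
    exists_isNewformOf ∧
    hsieh2014_exists_anticyclotomicPAdicLFunction ∧
    (∀ (N : ℕ) [NeZero N] (W : WeierstrassCurve ℚ) (K : Type) [Field K] [NumberField K],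
      gross_zagier N W K) ∧
    (∀ (N : ℕ) [NeZero N] (W : WeierstrassCurve ℚ) (K : Type) [Field K] [NumberField K],
      kolyvagin N W K) ∧
    rank_eq_analyticRank_of_analyticRank_le_one ∧ HoffsteinLuo1997_exists_twist_L_one_ne_zero ∧
    mazur_not_dvd_maninConstant_of_odd ∧ bsdRHS_eq_of_isIsogenous) ∧
    thm210_thm211_bdpDisplay_pNew) ∧
    LiuZhangZhang2018.thm151_thm153_modularCurve_heegnerVector) ∧
    (prop125_characterGrSelmerDual_torsion_muZero_dim ∧ prop263_sur_of_crk ∧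
      cor126_residualCharacter_globalLift ∧ cor126_residualCharacter_localSurjective ∧ prop411_selmer_isAlmostDivisible ∧
      thm212_exists_isKatzLFunction ∧
      CastellaGrossiLeeSkinner2022.thm122_fe_omegaPartner_charGrDual_torsion_muZero_lambda_eq ∧
      CastellaGrossiLeeSkinner2022.thm122_charGrDual_torsion_muZero_firstUnit_lambda_eq ∧
      Literature.NumberTheory.EllipticCurves.Castella2018.cas20_thm211_memberForms_sigmaFrames_congr))
    (hPre :
    Literature.NumberTheory.EllipticCurves.KellerYin2024.thm308_imc2_hidaMember_dvd_OPEN ∧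
      Literature.NumberTheory.EllipticCurves.KellerYin2024.thm222_anacong_hidaMember_sigma_mu_OPEN ∧
      Literature.NumberTheory.EllipticCurves.KellerYin2024.thm222_anacong_hidaMember_sigma_lambda_OPEN)
    (hCar :
    ∀ (W : WeierstrassCurve ℚ) [W.IsElliptic] [W.IsGloballyMinimal] (p : ℕ) [Fact p.Prime],
    ∀ (N : ℕ) [NeZero N] (K : Type) [Field K] [NumberField K] (Dt : ModularParametrizationData W N)
      (H : HeegnerDatum N (NumberField.discr K)) (ιK : K →+* ℂ) (P : (W.baseChange K).toAffine.Point),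
      CellC W p → W.conductorNorm ℤ = N →
      IsImaginaryQuadratic K → NumberField.discr K < -4 → SatisfiesHeegnerHypothesis N K →
      (W.quadraticTwist (NumberField.discr K : ℚ)).entireLFunction 1 ≠ 0 →
      WeierstrassCurve.Affine.Point.map ιK.toRatAlgHom P = heegnerPointComplex Dt H →
      ¬ (p : ℤ) ∣ Dt.c → ¬ IsOfFinAddOrder P →
      Odd (NumberField.discr K) →
      ∀ (κ : ZpExtension K p), κ.IsAnticyclotomic →
        ∀ (γ : Field.absoluteGaloisGroup K) [Fact (κ.IsTopGenerator γ)]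
          (𝔭 : HeightOneSpectrum (𝓞 K)), ((p : ℕ) : 𝓞 K) ∈ 𝔭.asIdeal →
          𝔭.asIdeal.ramificationIdx (𝓞 ℚ) = 1 → 𝔭.asIdeal.inertiaDeg (𝓞 ℚ) = 1 →
          ∀ (𝔭bar : HeightOneSpectrum (𝓞 K)), ((p : ℕ) : 𝓞 K) ∈ 𝔭bar.asIdeal → 𝔭bar ≠ 𝔭 →
            ((Ideal.span {(p : ℤ)}).primesOver (𝓞 K)).ncard = 2 →
          ∀ (f : CuspForm (CongruenceSubgroup.Gamma0 N) 2), IsNewformOf W f →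
            ∀ (ι' : PadicAlgCl p ≃+* ℂ),
              (∀ (w : InfinitePlace K) (k : 𝓞 K),
                k ∈ 𝔭.asIdeal ↔ ‖ι'.symm (w.embedding (k : K))‖ < 1) →
              ∀ (ΩK : ℂ) (Ωp : ℂ_[p]) (Q : PowerSeries 𝓞_ℂ_[p]), ΩK ≠ 0 → ‖Ωp‖ = 1 →
                R1.IsBDPLFunctionInt p ι' 𝔭 κ γ f ΩK Ωp Q →
      ∃ (F L : PowerSeries (PowerSeries (unrIntegers p))) (x : ℕ → ℤ_[p]),
        (∀ k, ‖x k‖ < 1) ∧ Filter.Tendsto x Filter.atTop (nhds 0) ∧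
        ¬ (PowerSeries.C (PowerSeries.X : PowerSeries (unrIntegers p)) ∣ F) ∧
        (∃ j : ℕ, PowerSeries.C ((p : 𝓞_ℂ_[p]) ^ j) *
            PowerSeries.map (R1.unrToCpInt p) (PowerSeries.map (PowerSeries.constantCoeff (R := unrIntegers p)) F) ∈
          (XAc.charIdeal (W.baseChange K) p κ 𝔭bar ∅ γ).map (PowerSeries.map (R1.toCpInt p))) ∧
        (∃ e : ℕ, PowerSeries.C ((p : 𝓞_ℂ_[p]) ^ e) * Q ∈
          Ideal.span {PowerSeries.map (R1.unrToCpInt p) (PowerSeries.map (PowerSeries.constantCoeff (R := unrIntegers p)) L)}) ∧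
        ∀ k : ℕ, ∃ (D : Skinner2016.HidaCongruentForm W p 1),
          (∀ y : coeffField D.g, ι' (D.ι y) = (y : ℂ)) ∧ 2 * ((p : ℤ) - 1) ∣ D.k - 2 ∧
          ∃ (ΩKg : ℂ) (Ωpg : ℂ_[p]) (Lg : UnrSeries p), ΩKg ≠ 0 ∧ ‖Ωpg‖ = 1 ∧
            IsBDPLFunctionWt ι' 𝔭 κ γ D.g ΩKg Ωpg Lg ∧
          ∃ (Φ Ψ : UnrSeries p),
            (∃ G U : PowerSeries (PowerSeries (unrIntegers p)),
              PowerSeries.map (PowerSeries.C (R := unrIntegers p)) Φ =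
                F * G + PowerSeries.C (PowerSeries.X - PowerSeries.C (toUnr p (x k))) * U) ∧
            (∃ U : PowerSeries (PowerSeries (unrIntegers p)),
              PowerSeries.map (PowerSeries.C (R := unrIntegers p)) Ψ =
                L + PowerSeries.C (PowerSeries.X - PowerSeries.C (toUnr p (x k))) * U) ∧
            (∃ e : ℕ, PowerSeries.C ((p : 𝓞_ℂ_[p]) ^ e) * PowerSeries.map (R1.unrToCpInt p) Ψ ∈
              Ideal.span {PowerSeries.map (R1.unrToCpInt p) Lg}) ∧
            ∀ (b : padicCoeffIntegers D.ι →+* 𝓞_ℂ_[p]),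
              (∀ y, ((b y : 𝓞_ℂ_[p]) : ℂ_[p]) =
                algebraMap (PadicAlgCl p) ℂ_[p] (padicCoeffIntegers.toPadicAlgCl D.ι y)) →
            ∀ [TopologicalSpace (PowerSeries (padicCoeffIntegers D.ι))]
              [ContinuousSMul (PowerSeries (padicCoeffIntegers D.ι))
                (BigRepModule (padicCoeffIntegers D.ι) p (Cofree D.Δ.selfDualRep (padicCoeffField D.ι)))],
              ∃ j : ℕ, Ideal.span {PowerSeries.C ((p : 𝓞_ℂ_[p]) ^ j)} *
                  (XBig.charIdeal κ (D.Δ.selfDualCofreeRepOver K) 𝔭bar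
                    (∅ : Set (HeightOneSpectrum (𝓞 K)))).map (PowerSeries.map b) ≤
                Ideal.span {PowerSeries.map (R1.unrToCpInt p) Φ})
    (hWall :
    (∀ (p : ℕ) [Fact p.Prime],
      2 < p → ∀ (K : Type) [Field K] [NumberField K], IsImaginaryQuadratic K →
        SatisfiesHeegnerHypothesis p K → Odd (NumberField.discr K) → NumberField.discr K ≠ -3 →
      ∀ (ι : K →+* ℚ_[p]) (v vbar : HeightOneSpectrum (𝓞 K)),
        (∀ x : 𝓞 K, x ∈ v.asIdeal ↔ ‖ι (x : K)‖ < 1) →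
        ((p : ℕ) : 𝓞 K) ∈ vbar.asIdeal → vbar ≠ v →
      ∀ (κ : ZpExtension K p), κ.IsAnticyclotomic →
      ∀ (γ : absoluteGaloisGroup K) [Fact (κ.IsTopGenerator γ)],
      ∀ (ι' : PadicAlgCl p ≃+* ℂ),
        (∀ (w : InfinitePlace K) (k : 𝓞 K), k ∈ v.asIdeal ↔ ‖ι'.symm (w.embedding (k : K))‖ < 1) →
      ∀ (θ : FramedGaloisRep ℚ (padicCoeffIntegers (∅ : Set (PadicAlgCl p))) 1),
        (∀ σ : absoluteGaloisGroup ℚ, θ σ ^ (p - 1) = 1) →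
      ∀ (C : ℕ), SatisfiesHeegnerHypothesis C K →
        (∀ u : HeightOneSpectrum (𝓞 ℚ), ((C : ℤ) : 𝓞 ℚ) ∉ u.asIdeal → θ.IsUnramifiedAt u) →
        (∀ u : HeightOneSpectrum (𝓞 ℚ), ((p : ℕ) : 𝓞 ℚ) ∈ u.asIdeal → θ.IsUnramifiedAt u) →
        (∀ g ∈ decomp vbar, ∀ m : charModule (∅ : Set (PadicAlgCl p)) (θ.restrictField K), p • m = 0 → g • m = m) →
      ∀ (θK : HeckeCharacter K), IsHeckeCharOf ι' (θ.restrictField K) θK →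
      ∀ (D : DatumDualData κ γ (charModule (∅ : Set (PadicAlgCl p)) (θ.restrictField K))
          (Castella2018.AcSelmer.bdpData (charModule (∅ : Set (PadicAlgCl p)) (θ.restrictField K)) p vbar)
          (∅ : Set (HeightOneSpectrum (𝓞 K)))),
      ∀ (Cbar : Finset (HeightOneSpectrum (𝓞 K))), (∀ u ∈ Cbar, ¬ θK.IsUnramifiedAt u) →
      ∀ (ΩK : ℂ) (Ωp : (unrIntegers p)ˣ) (L : UnrSeries p), ΩK ≠ 0 →
        IsKatzLFunction ι' v vbar Cbar κ γ θK ΩK ((Ωp : unrIntegers p) : ℂ_[p]) L →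
      Module.Finite (IwasawaAlgebra p) D.X ∧ Module.IsTorsion (IwasawaAlgebra p) D.X ∧
        muInvariant p D.X = 0 ∧
        ∃ m : ℕ, FirstUnitCoeffAt L m ∧
          lambdaInvariant p D.X =
            m + (if ∀ σ : absoluteGaloisGroup K, θ.restrictField K σ = 1 then 1 else 0)) ∧
      (∀ (W : WeierstrassCurve ℚ) [W.IsElliptic] [W.IsGloballyMinimal] (p : ℕ) [Fact p.Prime],
      2 < p → Mult W p → W.HasSplitMultiplicativeReductionAtPrime p →
      ∀ (K : Type) [Field K] [NumberField K],
        IsImaginaryQuadratic K → SatisfiesHeegnerHypothesis (W.conductorNorm ℤ) K →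
        Odd (NumberField.discr K) → NumberField.discr K ≠ -3 →
        ∀ (κ : ZpExtension K p), κ.IsAnticyclotomic →
          ∀ (γ : Field.absoluteGaloisGroup K) [Fact (κ.IsTopGenerator γ)]
            (𝔭 : HeightOneSpectrum (𝓞 K)), ((p : ℕ) : 𝓞 K) ∈ 𝔭.asIdeal →
            𝔭.asIdeal.ramificationIdx (𝓞 ℚ) = 1 → 𝔭.asIdeal.inertiaDeg (𝓞 ℚ) = 1 →
            ∀ (𝔭bar : HeightOneSpectrum (𝓞 K)), ((p : ℕ) : 𝓞 K) ∈ 𝔭bar.asIdeal → 𝔭bar ≠ 𝔭 →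
              ((Ideal.span {(p : ℤ)}).primesOver (𝓞 K)).ncard = 2 →
            ∀ (ι' : PadicAlgCl p ≃+* ℂ),
              (∀ (w : InfinitePlace K) (k : 𝓞 K), k ∈ 𝔭.asIdeal ↔ ‖ι'.symm (w.embedding (k : K))‖ < 1) →
            ∀ (Φ : AddSubgroup (geomTorsion W (p : ℤ))), IsRationalLine W p Φ →
            ∀ (θsub θquot : FramedGaloisRep ℚ (padicCoeffIntegers (∅ : Set (PadicAlgCl p))) 1),
              IsTeichmullerLiftOn (∅ : Set (PadicAlgCl p)) (Φ.map (geomTorsion W (p : ℤ)).subtype) θsub →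
              IsTeichmullerLiftOnQuot (∅ : Set (PadicAlgCl p)) (Φ.map (geomTorsion W (p : ℤ)).subtype)
                (geomTorsion W (p : ℤ)) θquot →
            ∀ (φ ψ : FramedGaloisRep ℚ (padicCoeffIntegers (∅ : Set (PadicAlgCl p))) 1),
              (φ = θsub ∧ ψ = θquot ∨ φ = θquot ∧ ψ = θsub) →
              (∀ u : HeightOneSpectrum (𝓞 ℚ), ((p : ℕ) : 𝓞 ℚ) ∈ u.asIdeal → φ.IsUnramifiedAt u) →
            ∀ (θK : HeckeCharacter K), IsHeckeCharOf ι' (φ.restrictField K) θK →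
            ∀ (Cbar : Finset (HeightOneSpectrum (𝓞 K))), (∀ u ∈ Cbar, ¬ θK.IsUnramifiedAt u) →
            ∀ (ΩK' : ℂ) (Ωp' : (unrIntegers p)ˣ) (Lφ : UnrSeries p), ΩK' ≠ 0 →
              IsKatzLFunction ι' 𝔭 𝔭bar Cbar κ γ θK ΩK' ((Ωp' : unrIntegers p) : ℂ_[p]) Lφ →
            ∀ nφ : ℕ, FirstUnitCoeffAt Lφ nφ →
            ∀ (Dψ : DatumDualData κ γ (charModule (∅ : Set (PadicAlgCl p)) (ψ.restrictField K))
                (Castella2018.AcSelmer.bdpData (charModule (∅ : Set (PadicAlgCl p)) (ψ.restrictField K)) p 𝔭bar)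
                (∅ : Set (HeightOneSpectrum (𝓞 K)))),
              Module.Finite (IwasawaAlgebra p) Dψ.X ∧ Module.IsTorsion (IwasawaAlgebra p) Dψ.X ∧
                muInvariant p Dψ.X = 0 ∧ lambdaInvariant p Dψ.X = nφ))
    (hMCB :
    Summit.BirchSwinnertonDyer.BirchSwinnertonDyer.Theses.EisensteinPrimes.MazurMCOnCellB)
    : Summit.BirchSwinnertonDyer.BirchSwinnertonDyer.Theses.EisensteinPrimes.BSDpOnCellC :=
  bsdpOnCellC_of_namedFactsV16T hPub (memberDiv_of_thm308 hPre.1) hCar ⟨hPre.2.1, hPre.2.2⟩ hWall hMCB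

end Summit.BirchSwinnertonDyer.BirchSwinnertonDyer.Theorems.MemberDivOfThm308

end
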